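import Mathlib
import HarnessLib
import Summits.QuantumFields.YangMills.Theses.PencilRigidity
import Summits.QuantumFields.YangMills.Theorems.PencilRigidityCurvatureKernelBoundSmearedToLocalDecay
import Summits.QuantumFields.YangMills.Theorems.PencilRigidityCurvatureKernelBoundIffLocalDecay
import Summits.QuantumFields.YangMills.Theorems.PencilRigidityCurvatureKernelBoundSmearedBoundEventuallyOfCrux
import Summits.QuantumFields.YangMills.Theorems.PencilRigidityCurvatureKernelBoundKernelConclusionOfWitnessLocalDecay
import Summits.QuantumFields.YangMills.Theorems.PencilRigidityCurvatureKernelBoundHalfSpaceKernelLocalNorm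
import Summits.QuantumFields.YangMills.Theorems.PencilRigidityCurvatureKernelBoundCruxToLocalDecay

/-!
# `CurvatureKernelBound` — the WEAKEST exact lattice criterion: frequently in `k`, pure `L∞` form (support for stmt-QuantumFields-11687)

Crux `stmt-QuantumFields-11687` (`PencilRigidity.CurvatureKernelBound`), line `sixteen-charts-analytic-kernel`, skeleton v18
(continuation lead c6). **Statement.** `CurvatureKernelBound ↔ E^fr`, where E^fr (`SmearedFrequently`) says: for every `W₁`-datum
`(G, r, sch, S₁)` there are `C`, `η > 0`, `s₁ > 0` such that for every height `s ∈ (0, s₁)`, radius `0 < ρ ≤ s/2`, real Schwartz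
`f 0, f 1` supported in the closed `ρ`-balls about `−s e₀`, `+s e₀` with `|f 0| ≤ M₀`, `|f 1| ≤ M₁`, and every `δ > 0`, FREQUENTLY in
`k` the renormalised truncated lattice two-point function of the curvature species obeys
`|LS₂(f) − LS₁(f 0) LS₁(f 1)| ≤ C s^(η−10) ρ⁸ M₀ M₁ + δ`.
Among the exact lattice forms of the crux this is the weakest as a HYPOTHESIS (frequently instead of eventually; no `L¹` term —
`(∫|f 0|)(∫|f 1|) ≤ V² ρ⁸ M₀ M₁`, `V = vol B̄(0,1)`, so the `L¹` term of `SmearedBoundEventuallyOfCrux` is dominated), hence the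
form to hand to a UV prover, universally (`CurvatureKernelBoundIffSmearedFrequently`) or for ONE witness
(`KernelConclusionOfWitnessSmearedFrequently`, the existence-leg fold). The registered open stub E^sm `SmearedLatticeWindowBound`
implies it scheme by scheme (k-uniform window, lattice `L¹` norms `≤ (3ρ)⁴ M`).
**Proof.** `←` per datum (`LocalDecayOfSmearedFrequently`): the lattice tie of `W₁` at `n = 2, 1` gives convergence of the
complexified truncated smeared two-point function to `S₁ 2 F − S₁ 1 F₀ · S₁ 1 F₁`; a closed half-line contains the limit of a sequence
frequently inside it (`IsClosed.mem_of_frequently_of_tendsto`), then `δ ↓ 0`; `S₁ 1 = κ∫` bounds the disconnected part by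
`‖κ‖² (∫|f 0|)(∫|f 1|)`; so T holds with `A = ‖κ‖²`, `B = C⁺ s^(η−10)`, `η_T = min η 10`, `C_T = ‖κ‖² + C⁺`, `s₁' = min 1 s₁`,
`r₀ = s/2`; and `crux ← T` is `CurvatureKernelBoundIffLocalDecay` (p131429). `→` (`SmearedFrequentlyOfCrux`): the landed necessity
`SmearedBoundEventuallyOfCrux` (p131636) plus `(∫|f i|) ≤ M_i ρ⁴ V` (`integral_abs_le_of_tsupport_subset`, `Measure.addHaar_closedBall'`),
constant `C⁺ (V² + 1)`. [folklore]

**Per-witness section (appended, lead c6).** For ONE `W₁`-datum `(G, r, sch, S₁)` the kernel conclusion of the crux for `S₁` is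
EQUIVALENT to its two-point local decay T and to E^fr of `(sch, S₁)`: `KernelConclusionIffLocalDecayDatum`,
`KernelConclusionIffSmearedFrequentlyDatum` (necessity per datum: `LocalDecayOfKernelConclusion`, `SmearedEventuallyOfKernelConclusion`,
`SmearedFrequentlyOfKernelConclusion` — the per-datum contents of `CruxToLocalDecay` p130438 and `SmearedBoundEventuallyOfCrux` p131636;
sufficiency: the folds). So folding T (or E^fr) of the witness into the existence leg is LOSSLESS per witness.
-/

noncomputable section

open scoped BigOperators Topology SchwartzMap
open MeasureTheory Filter Set Metric
open Literature.MathematicalPhysics.QuantumLattice Literature.MathematicalPhysics.AQFT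
open Literature.MathematicalPhysics.QuantumFieldTheory

namespace Summit.QuantumFields.YangMills.Theorems.CurvatureKernel

namespace SmearedFrequentlyAux

/-- **A closed half-line contains the limit of a sequence frequently inside it**: `u k → L` in `ℂ` and
`‖u k‖ ≤ B` frequently give `‖L‖ ≤ B`. [folklore] -/
theorem norm_le_of_frequently_le {u : ℕ → ℂ} {L : ℂ} {B : ℝ} (hu : Tendsto u atTop (𝓝 L))
    (h : ∃ᶠ k in atTop, ‖u k‖ ≤ B) : ‖L‖ ≤ B :=
  isClosed_Iic.mem_of_frequently_of_tendsto h hu.norm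

/-- **Volume of a closed ball in `ℝ⁴`**: `vol B̄(c, ρ) = ρ⁴ · vol B̄(0, 1)` (real-valued), `0 ≤ ρ`. [folklore] -/
theorem volume_closedBall_toReal (c : EuclideanSpace ℝ (Fin 4)) {ρ : ℝ} (hρ : 0 ≤ ρ) :
    (volume (closedBall c ρ)).toReal =
      ρ ^ 4 * (volume (closedBall (0 : EuclideanSpace ℝ (Fin 4)) 1)).toReal := by
  rw [Measure.addHaar_closedBall' volume c hρ, finrank_euclideanSpace_fin, ENNReal.toReal_mul,
    ENNReal.toReal_ofReal (by positivity)]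

/-- **`L¹` by `L∞` on a ball**: a function supported in `B̄(c, ρ)` and bounded by `M` has `∫|g| ≤ M ρ⁴ vol B̄(0,1)`. [folklore] -/
theorem integral_abs_le_pow_four (g : 𝓢(EuclideanSpace ℝ (Fin 4), ℝ)) (c : EuclideanSpace ℝ (Fin 4)) {ρ M : ℝ}
    (hρ : 0 ≤ ρ) (hg : tsupport (g : EuclideanSpace ℝ (Fin 4) → ℝ) ⊆ closedBall c ρ) (hM : ∀ x, |g x| ≤ M) :
    ∫ x, |g x| ≤ M * (ρ ^ 4 * (volume (closedBall (0 : EuclideanSpace ℝ (Fin 4)) 1)).toReal) := by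
  rw [← volume_closedBall_toReal c hρ]
  exact integral_abs_le_of_tsupport_subset g c ρ M hg hM

/-- **Constant bookkeeping for the necessity direction**: with `I₀ ≤ M₀ ρ⁴ V`, `I₁ ≤ M₁ ρ⁴ V` (all nonnegative) and `C ≤ C⁺`,
`0 ≤ C⁺`, `0 ≤ t`: `C t (I₀ I₁ + ρ⁸ M₀ M₁) ≤ C⁺ (V² + 1) t (ρ⁸ M₀ M₁)`. [folklore] -/
theorem mixed_le_pure {C Cp t I₀ I₁ M₀ M₁ ρ V : ℝ} (hC : C ≤ Cp) (hCp : 0 ≤ Cp) (ht : 0 ≤ t)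
    (hI₀ : I₀ ≤ M₀ * (ρ ^ 4 * V)) (hI₁ : I₁ ≤ M₁ * (ρ ^ 4 * V)) (hI₀nn : 0 ≤ I₀) (hI₁nn : 0 ≤ I₁)
    (hM₀ : 0 ≤ M₀) (hM₁ : 0 ≤ M₁) (hV : 0 ≤ V) :
    C * t * (I₀ * I₁ + ρ ^ 8 * M₀ * M₁) ≤ Cp * (V ^ 2 + 1) * t * (ρ ^ 8 * M₀ * M₁) := by
  have hX : 0 ≤ I₀ * I₁ + ρ ^ 8 * M₀ * M₁ := by positivity
  have h1 : C * t * (I₀ * I₁ + ρ ^ 8 * M₀ * M₁) ≤ Cp * t * (I₀ * I₁ + ρ ^ 8 * M₀ * M₁) :=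
    mul_le_mul_of_nonneg_right (mul_le_mul_of_nonneg_right hC ht) hX
  have h2 : I₀ * I₁ ≤ (M₀ * (ρ ^ 4 * V)) * (M₁ * (ρ ^ 4 * V)) :=
    mul_le_mul hI₀ hI₁ hI₁nn (by positivity)
  have h3 : (M₀ * (ρ ^ 4 * V)) * (M₁ * (ρ ^ 4 * V)) = V ^ 2 * (ρ ^ 8 * M₀ * M₁) := by ring
  have h4 : I₀ * I₁ + ρ ^ 8 * M₀ * M₁ ≤ (V ^ 2 + 1) * (ρ ^ 8 * M₀ * M₁) := by nlinarith
  have h5 : Cp * t * (I₀ * I₁ + ρ ^ 8 * M₀ * M₁) ≤ Cp * t * ((V ^ 2 + 1) * (ρ ^ 8 * M₀ * M₁)) :=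
    mul_le_mul_of_nonneg_left h4 (by positivity)
  linarith

end SmearedFrequentlyAux

open TwoPointLocal SemiDegenerate BoundedRenormalisation SmearedToLocalDecayAux SmearedFrequentlyAux in
/-- **`LocalDecayOfSmearedFrequently`** (per datum; support for stmt-QuantumFields-11687, line `sixteen-charts-analytic-kernel`):
ONE `W₁`-datum + the testwise FREQUENT pure-`L∞` smeared bound on its renormalised truncated lattice two-point function ⇒ the local
two-point decay T for that family (`A = ‖κ‖²`, `B = C⁺ s^(η−10)`, `η_T = min η 10`, `C_T = ‖κ‖² + C⁺`, `s₁' = min 1 s₁`). [folklore] -/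
theorem LocalDecayOfSmearedFrequently : open Literature.MathematicalPhysics.QuantumLattice Literature.MathematicalPhysics.AQFT Literature.MathematicalPhysics.QuantumFieldTheory in ∀ (G : Type) [Group G] [TopologicalSpace G] [IsTopologicalGroup G] [CompactSpace G] [MeasurableSpace G] [BorelSpace G], IsCompactSimpleLieGroup G → ∀ (r : LatticeRep G) (sch : SpeciesScheme (YMSpecies G)) (S₁ : SchwingerFamily (EuclideanSpace ℝ (Fin 4))), ((∀ (n : ℕ), n ≠ 0 → ∀ (f : Fin n → SchwartzMap (EuclideanSpace ℝ (Fin 4)) ℝ) (F : SchwartzMap (Fin n → (EuclideanSpace ℝ (Fin 4))) ℂ), IsTensorOf F (fun i => ofRealTest (f i)) → IsOffDiagonal F → Filter.Tendsto (fun k : ℕ => ((latticeSchwinger r.ρ sch (fun s => s.F) k n (fun _ => r.curvature) f : ℝ) : ℂ)) Filter.atTop (nhds (S₁ n F))) ∧ (S₁.toLabelled.IsNormalized ∧ S₁.toLabelled.IsHermitian ∧ S₁.toLabelled.HasLinearGrowth ∧ S₁.toLabelled.IsReflectionPositive ∧ S₁.toLabelled.IsSymmetric ∧ S₁.toLabelled.HasClusterProperty)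 ∧ (∀ (n : ℕ) (a : (EuclideanSpace ℝ (Fin 4))) (F : SchwartzMap (Fin n → (EuclideanSpace ℝ (Fin 4))) ℂ), IsOffDiagonal F → S₁ n (translateMulti a F) = S₁ n F) ∧ (∀ (R : (EuclideanSpace ℝ (Fin 4)) ≃ₗᵢ[ℝ] (EuclideanSpace ℝ (Fin 4))), LinearMap.det (R.toLinearEquiv : (EuclideanSpace ℝ (Fin 4)) →ₗ[ℝ] (EuclideanSpace ℝ (Fin 4))) = 1 → (∀ i : Fin 4, ∃ j : Fin 4, R (EuclideanSpace.single i 1) = EuclideanSpace.single j 1 ∨ R (EuclideanSpace.single i 1) = -EuclideanSpace.single j 1) → ∀ (n : ℕ) (F : SchwartzMap (Fin n → (EuclideanSpace ℝ (Fin 4))) ℂ), IsOffDiagonal F → S₁ n (linActMulti R F) = S₁ n F) ∧ (∃ Δ : ℝ, 0 < Δ ∧ S₁.toLabelled.HasMassGap Δ ∧ HasLatticeMassGap r sch Δ)) → (∃ (C η s₁ : ℝ), 0 < η ∧ 0 < s₁ ∧ ∀ (s : ℝ), 0 < s → s < s₁ → ∀ (ρ : ℝ), 0 < ρ → ρ ≤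 s / 2 → ∀ (f : Fin 2 → SchwartzMap (EuclideanSpace ℝ (Fin 4)) ℝ) (M₀ M₁ : ℝ), tsupport ((f 0 : SchwartzMap (EuclideanSpace ℝ (Fin 4)) ℝ) : (EuclideanSpace ℝ (Fin 4)) → ℝ) ⊆ Metric.closedBall (EuclideanSpace.single (0 : Fin 4) (-s)) ρ → tsupport ((f 1 : SchwartzMap (EuclideanSpace ℝ (Fin 4)) ℝ) : (EuclideanSpace ℝ (Fin 4)) → ℝ) ⊆ Metric.closedBall (EuclideanSpace.single (0 : Fin 4) s) ρ → (∀ x, |f 0 x| ≤ M₀) → (∀ x, |f 1 x| ≤ M₁) → ∀ (δ : ℝ), 0 < δ → ∃ᶠ k in Filter.atTop, |latticeSchwinger r.ρ sch (fun s => s.F) k 2 (fun _ => r.curvature) f - latticeSchwinger r.ρ sch (fun s => s.F) k 1 (fun _ => r.curvature) (fun _ => f 0) * latticeSchwinger r.ρ sch (fun s => s.F) k 1 (fun _ => r.curvature) (fun _ => f 1)| ≤ C * s ^ (η - 10) * (ρ ^ 8 * M₀ * M₁) + δ) → ∃ (C η s₁ : ℝ), 0 < η ∧ 0 < s₁ ∧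 (∀ (s : ℝ), 0 < s → s < s₁ → ∃ (r₀ A B : ℝ), 0 < r₀ ∧ 0 ≤ A ∧ 0 ≤ B ∧ A + B ≤ C * s ^ (η - 10) ∧ (∀ (r : ℝ), 0 < r → r ≤ r₀ → ∀ (f : Fin 2 → SchwartzMap (EuclideanSpace ℝ (Fin 4)) ℝ) (F : SchwartzMap (Fin 2 → (EuclideanSpace ℝ (Fin 4))) ℂ) (M₀ M₁ : ℝ), IsTensorOf F (fun i => ofRealTest (f i)) → tsupport ((f 0 : SchwartzMap (EuclideanSpace ℝ (Fin 4)) ℝ) : (EuclideanSpace ℝ (Fin 4)) → ℝ) ⊆ Metric.closedBall (EuclideanSpace.single (0 : Fin 4) (-s)) r → tsupport ((f 1 : SchwartzMap (EuclideanSpace ℝ (Fin 4)) ℝ) : (EuclideanSpace ℝ (Fin 4)) → ℝ) ⊆ Metric.closedBall (EuclideanSpace.single (0 : Fin 4) s) r → (∀ x, |f 0 x| ≤ M₀) → (∀ x, |f 1 x| ≤ M₁) → ‖S₁ 2 F‖ ≤ A * (∫ x : (EuclideanSpace ℝ (Fin 4)), |f 0 x|) * (∫ x : (EuclideanSpace ℝ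 (Fin 4)), |f 1 x|) + B * r ^ 8 * M₀ * M₁)) := by
  intro G _ _ _ _ _ _ _ r sch S₁ hW₁ hFr
  obtain ⟨htie, -, htr, -, -⟩ := hW₁
  obtain ⟨C, η, s₁, hη, hs₁, hfr⟩ := hFr
  obtain ⟨κ, hκ⟩ := exists_degreeOne_eq_const_mul_realIntegral S₁ htr
  obtain ⟨Cp, hCCp, hCpnn⟩ : ∃ Cp : ℝ, C ≤ Cp ∧ 0 ≤ Cp := ⟨max C 0, le_max_left _ _, le_max_right _ _⟩
  refine ⟨‖κ‖ ^ 2 + Cp, min η 10, min 1 s₁, lt_min hη (by norm_num), lt_min one_pos hs₁, ?_⟩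
  intro s hs hs₁'
  have hs1 : s ≤ 1 := hs₁'.le.trans (min_le_left _ _)
  have hss₁ : s < s₁ := lt_of_lt_of_le hs₁' (min_le_right _ _)
  obtain ⟨D, hDdef, hDnn⟩ : ∃ D : ℝ, D = Cp * s ^ (η - 10) ∧ 0 ≤ D := ⟨_, rfl, by positivity⟩
  refine ⟨s / 2, ‖κ‖ ^ 2, D, half_pos hs, by positivity, hDnn, ?_, ?_⟩
  · have key := const_add_mul_rpow_le (A := ‖κ‖ ^ 2) (Q := Cp) (η := η) (by positivity) hCpnn hs hs1
    rw [hDdef]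
    exact key
  · intro ρ hρ hρs f F M₀ M₁ hFt hsupp₀ hsupp₁ hM₀ hM₁
    have hM₀nn : 0 ≤ M₀ := (abs_nonneg _).trans (hM₀ 0)
    have hM₁nn : 0 ≤ M₁ := (abs_nonneg _).trans (hM₁ 0)
    have hdisj : Disjoint (tsupport ((f 0 : 𝓢(EuclideanSpace ℝ (Fin 4), ℝ)) : EuclideanSpace ℝ (Fin 4) → ℝ))
        (tsupport ((f 1 : 𝓢(EuclideanSpace ℝ (Fin 4), ℝ)) : EuclideanSpace ℝ (Fin 4) → ℝ)) :=
      Disjoint.mono hsupp₀ hsupp₁ (disjoint_closedBall_single hs hρs)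
    have hFoff : IsOffDiagonal F := isOffDiagonal_of_isTensorOf_of_disjoint hFt hdisj
    obtain ⟨F₀, hF₀⟩ := exists_isTensorOf (n := 1) (fun _ : Fin 1 => ofRealTest (f 0))
    obtain ⟨F₁, hF₁⟩ := exists_isTensorOf (n := 1) (fun _ : Fin 1 => ofRealTest (f 1))
    have hu := htie 2 two_ne_zero f F hFt hFoff
    have hv := htie 1 one_ne_zero (fun _ => f 0) F₀ hF₀ (HypercubicLimit.Negative.isOffDiagonal_fin_one F₀)
    have hw := htie 1 one_ne_zero (fun _ => f 1) F₁ hF₁ (HypercubicLimit.Negative.isOffDiagonal_fin_one F₁)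
    -- (1) the frequent smeared bound passes to the limit, for every `δ > 0`
    have hZδ : ∀ δ : ℝ, 0 < δ → ‖S₁ 2 F - S₁ 1 F₀ * S₁ 1 F₁‖ ≤ D * (ρ ^ 8 * M₀ * M₁) + δ := by
      intro δ hδ
      refine norm_le_of_frequently_le (hu.sub (hv.mul hw)) ?_
      refine (hfr s hs hss₁ ρ hρ hρs f M₀ M₁ hsupp₀ hsupp₁ hM₀ hM₁ δ hδ).mono fun k hk => ?_
      rw [← Complex.ofReal_mul, ← Complex.ofReal_sub, Complex.norm_real, Real.norm_eq_abs]
      refine hk.trans ?_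
      have hX : 0 ≤ ρ ^ 8 * M₀ * M₁ := by positivity
      have hCD : C * s ^ (η - 10) ≤ D := by
        rw [hDdef]
        exact mul_le_mul_of_nonneg_right hCCp (Real.rpow_nonneg hs.le _)
      nlinarith
    have hZ : ‖S₁ 2 F - S₁ 1 F₀ * S₁ 1 F₁‖ ≤ D * (ρ ^ 8 * M₀ * M₁) :=
      le_of_forall_pos_le_add fun δ hδ => hZδ δ hδ
    -- (2) the disconnected part is `κ² (∫ f₀)(∫ f₁)`, bounded by `‖κ‖² (∫|f₀|)(∫|f₁|)`
    rw [hκ (f 0) F₀ hF₀, hκ (f 1) F₁ hF₁] at hZ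
    have hP := norm_disconnected_le κ f
    -- (3) assembly
    have hfin := TwoPointLocal.norm_le_of_norm_sub_le hZ hP
    have hring : D * (ρ ^ 8 * M₀ * M₁) = D * ρ ^ 8 * M₀ * M₁ := by ring
    linarith

open SmearedFrequentlyAux in
/-- **`SmearedFrequentlyOfCrux`** (necessity; support for stmt-QuantumFields-11687): the crux forces, for every `W₁`-datum, the
testwise frequent pure-`L∞` smeared bound — from the landed `SmearedBoundEventuallyOfCrux` and `(∫|f i|) ≤ M_i ρ⁴ vol B̄(0,1)`,
constant `C⁺ (V² + 1)`. [folklore] -/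
theorem SmearedFrequentlyOfCrux : open Literature.MathematicalPhysics.QuantumLattice Literature.MathematicalPhysics.AQFT Literature.MathematicalPhysics.QuantumFieldTheory in Summit.QuantumFields.YangMills.Theses.PencilRigidity.CurvatureKernelBound → ∀ (G : Type) [Group G] [TopologicalSpace G] [IsTopologicalGroup G] [CompactSpace G] [MeasurableSpace G] [BorelSpace G], IsCompactSimpleLieGroup G → ∀ (r : LatticeRep G) (sch : SpeciesScheme (YMSpecies G)) (S₁ : SchwingerFamily (EuclideanSpace ℝ (Fin 4))), ((∀ (n : ℕ), n ≠ 0 → ∀ (f : Fin n → SchwartzMap (EuclideanSpace ℝ (Fin 4)) ℝ) (F : SchwartzMap (Fin n → (EuclideanSpace ℝ (Fin 4))) ℂ), IsTensorOf F (fun i => ofRealTest (f i)) → IsOffDiagonal F → Filter.Tendsto (fun k : ℕ => ((latticeSchwinger r.ρ sch (fun s => s.F) k n (fun _ => r.curvature) f : ℝ) : ℂ)) Filter.atTop (nhds (S₁ n F))) ∧ (S₁.toLabelled.IsNormalized ∧ S₁.toLabelled.IsHermitian ∧ S₁.toLabelled.HasLinearGrowth ∧ S₁.toLabelled.IsReflectionPositive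 ∧ S₁.toLabelled.IsSymmetric ∧ S₁.toLabelled.HasClusterProperty) ∧ (∀ (n : ℕ) (a : (EuclideanSpace ℝ (Fin 4))) (F : SchwartzMap (Fin n → (EuclideanSpace ℝ (Fin 4))) ℂ), IsOffDiagonal F → S₁ n (translateMulti a F) = S₁ n F) ∧ (∀ (R : (EuclideanSpace ℝ (Fin 4)) ≃ₗᵢ[ℝ] (EuclideanSpace ℝ (Fin 4))), LinearMap.det (R.toLinearEquiv : (EuclideanSpace ℝ (Fin 4)) →ₗ[ℝ] (EuclideanSpace ℝ (Fin 4))) = 1 → (∀ i : Fin 4, ∃ j : Fin 4, R (EuclideanSpace.single i 1) = EuclideanSpace.single j 1 ∨ R (EuclideanSpace.single i 1) = -EuclideanSpace.single j 1) → ∀ (n : ℕ) (F : SchwartzMap (Fin n → (EuclideanSpace ℝ (Fin 4))) ℂ), IsOffDiagonal F → S₁ n (linActMulti R F) = S₁ n F) ∧ (∃ Δ : ℝ, 0 < Δ ∧ S₁.toLabelled.HasMassGap Δ ∧ HasLatticeMassGap r sch Δ)) → ∃ (C η s₁ : ℝ), 0 < η ∧ 0 < s₁ ∧ ∀ (s :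 ℝ), 0 < s → s < s₁ → ∀ (ρ : ℝ), 0 < ρ → ρ ≤ s / 2 → ∀ (f : Fin 2 → SchwartzMap (EuclideanSpace ℝ (Fin 4)) ℝ) (M₀ M₁ : ℝ), tsupport ((f 0 : SchwartzMap (EuclideanSpace ℝ (Fin 4)) ℝ) : (EuclideanSpace ℝ (Fin 4)) → ℝ) ⊆ Metric.closedBall (EuclideanSpace.single (0 : Fin 4) (-s)) ρ → tsupport ((f 1 : SchwartzMap (EuclideanSpace ℝ (Fin 4)) ℝ) : (EuclideanSpace ℝ (Fin 4)) → ℝ) ⊆ Metric.closedBall (EuclideanSpace.single (0 : Fin 4) s) ρ → (∀ x, |f 0 x| ≤ M₀) → (∀ x, |f 1 x| ≤ M₁) → ∀ (δ : ℝ), 0 < δ → ∃ᶠ k in Filter.atTop, |latticeSchwinger r.ρ sch (fun s => s.F) k 2 (fun _ => r.curvature) f - latticeSchwinger r.ρ sch (fun s => s.F) k 1 (fun _ => r.curvature) (fun _ => f 0) * latticeSchwinger r.ρ sch (fun s => s.F) k 1 (fun _ => r.curvature) (fun _ => f 1)| ≤ C * s ^ (η - 10) * (ρ ^ 8 * M₀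 * M₁) + δ := by
  intro hKB G _ _ _ _ _ _ hG r sch S₁ hW₁
  obtain ⟨C, η, s₁, hη, hs₁, hev⟩ := SmearedBoundEventuallyOfCrux hKB G hG r sch S₁ hW₁
  set V : ℝ := (volume (closedBall (0 : EuclideanSpace ℝ (Fin 4)) 1)).toReal with hV
  refine ⟨max C 0 * (V ^ 2 + 1), η, s₁, hη, hs₁, ?_⟩
  intro s hs hss₁ ρ hρ hρs f M₀ M₁ hsupp₀ hsupp₁ hM₀ hM₁ δ hδ
  have hM₀nn : 0 ≤ M₀ := (abs_nonneg _).trans (hM₀ 0)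
  have hM₁nn : 0 ≤ M₁ := (abs_nonneg _).trans (hM₁ 0)
  have hI₀ := integral_abs_le_pow_four (f 0) _ hρ.le hsupp₀ hM₀
  have hI₁ := integral_abs_le_pow_four (f 1) _ hρ.le hsupp₁ hM₁
  refine ((hev s hs hss₁ ρ hρ hρs f M₀ M₁ hsupp₀ hsupp₁ hM₀ hM₁ δ hδ).mono fun k hk => hk.trans ?_).frequently
  have key := mixed_le_pure (t := s ^ (η - 10)) (le_max_left C 0) (le_max_right C 0) (Real.rpow_nonneg hs.le _)
    hI₀ hI₁ (integral_nonneg fun x => abs_nonneg _) (integral_nonneg fun x => abs_nonneg _) hM₀nn hM₁nn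
    ENNReal.toReal_nonneg
  linarith

/-- **`CurvatureKernelBoundIffSmearedFrequently`** (support for stmt-QuantumFields-11687, skeleton v18 of line
`sixteen-charts-analytic-kernel`): the crux `CurvatureKernelBound` is EQUIVALENT to the testwise, frequently-in-`k`, pure-`L∞`
smeared bound on the renormalised truncated lattice two-point function of the curvature species for every `W₁`-datum — the
weakest of its exact lattice forms, the one to hand to a UV construction. [folklore] -/
theorem CurvatureKernelBoundIffSmearedFrequently : open Literature.MathematicalPhysics.QuantumLattice Literature.MathematicalPhysics.AQFT Literature.MathematicalPhysics.QuantumFieldTheory in Summit.QuantumFields.YangMills.Theses.PencilRigidity.CurvatureKernelBound ↔ (∀ (G : Type) [Group G] [TopologicalSpace G] [IsTopologicalGroup G] [CompactSpace G] [MeasurableSpace G] [BorelSpace G], IsCompactSimpleLieGroup G → ∀ (r : LatticeRep G) (sch : SpeciesScheme (YMSpecies G)) (S₁ : SchwingerFamily (EuclideanSpace ℝ (Fin 4))), ((∀ (n : ℕ), n ≠ 0 → ∀ (f : Fin n → SchwartzMap (EuclideanSpace ℝ (Fin 4)) ℝ) (F : SchwartzMap (Fin n → (EuclideanSpace ℝ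 (Fin 4))) ℂ), IsTensorOf F (fun i => ofRealTest (f i)) → IsOffDiagonal F → Filter.Tendsto (fun k : ℕ => ((latticeSchwinger r.ρ sch (fun s => s.F) k n (fun _ => r.curvature) f : ℝ) : ℂ)) Filter.atTop (nhds (S₁ n F))) ∧ (S₁.toLabelled.IsNormalized ∧ S₁.toLabelled.IsHermitian ∧ S₁.toLabelled.HasLinearGrowth ∧ S₁.toLabelled.IsReflectionPositive ∧ S₁.toLabelled.IsSymmetric ∧ S₁.toLabelled.HasClusterProperty) ∧ (∀ (n : ℕ) (a : (EuclideanSpace ℝ (Fin 4))) (F : SchwartzMap (Fin n → (EuclideanSpace ℝ (Fin 4))) ℂ), IsOffDiagonal F → S₁ n (translateMulti a F) = S₁ n F) ∧ (∀ (R : (EuclideanSpace ℝ (Fin 4)) ≃ₗᵢ[ℝ] (EuclideanSpace ℝ (Fin 4))), LinearMap.det (R.toLinearEquiv : (EuclideanSpace ℝ (Fin 4)) →ₗ[ℝ] (EuclideanSpace ℝ (Fin 4))) = 1 → (∀ i : Fin 4, ∃ j : Fin 4, R (EuclideanSpace.single i 1) = EuclideanSpace.single j 1 ∨ R (EuclideanSpace.single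 i 1) = -EuclideanSpace.single j 1) → ∀ (n : ℕ) (F : SchwartzMap (Fin n → (EuclideanSpace ℝ (Fin 4))) ℂ), IsOffDiagonal F → S₁ n (linActMulti R F) = S₁ n F) ∧ (∃ Δ : ℝ, 0 < Δ ∧ S₁.toLabelled.HasMassGap Δ ∧ HasLatticeMassGap r sch Δ)) → ∃ (C η s₁ : ℝ), 0 < η ∧ 0 < s₁ ∧ ∀ (s : ℝ), 0 < s → s < s₁ → ∀ (ρ : ℝ), 0 < ρ → ρ ≤ s / 2 → ∀ (f : Fin 2 → SchwartzMap (EuclideanSpace ℝ (Fin 4)) ℝ) (M₀ M₁ : ℝ), tsupport ((f 0 : SchwartzMap (EuclideanSpace ℝ (Fin 4)) ℝ) : (EuclideanSpace ℝ (Fin 4)) → ℝ) ⊆ Metric.closedBall (EuclideanSpace.single (0 : Fin 4) (-s)) ρ → tsupport ((f 1 : SchwartzMap (EuclideanSpace ℝ (Fin 4)) ℝ) : (EuclideanSpace ℝ (Fin 4)) → ℝ) ⊆ Metric.closedBall (EuclideanSpace.single (0 : Fin 4) s) ρ → (∀ x, |f 0 x| ≤ M₀) → (∀ x, |f 1 x|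 ≤ M₁) → ∀ (δ : ℝ), 0 < δ → ∃ᶠ k in Filter.atTop, |latticeSchwinger r.ρ sch (fun s => s.F) k 2 (fun _ => r.curvature) f - latticeSchwinger r.ρ sch (fun s => s.F) k 1 (fun _ => r.curvature) (fun _ => f 0) * latticeSchwinger r.ρ sch (fun s => s.F) k 1 (fun _ => r.curvature) (fun _ => f 1)| ≤ C * s ^ (η - 10) * (ρ ^ 8 * M₀ * M₁) + δ) :=
  ⟨SmearedFrequentlyOfCrux, fun hFr => CurvatureKernelBoundIffLocalDecay.mpr
    fun G _ _ _ _ _ _ hG r sch S₁ hW₁ => LocalDecayOfSmearedFrequently G hG r sch S₁ hW₁ (hFr G hG r sch S₁ hW₁)⟩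

/-- **`KernelConclusionOfWitnessSmearedFrequently`** (existence-leg fold, weakest lattice currency; support for stmt-QuantumFields-11687):
ONE `W₁`-datum + the testwise frequent pure-`L∞` smeared bound of its scheme ⇒ the conclusion of `CurvatureKernelBound` for that
family (`KernelConclusionOfWitnessLocalDecay ∘ LocalDecayOfSmearedFrequently`). The clause a planner folds into
`WeakCouplingHypercubicLimit` to consume the crux per witness. [folklore] -/
theorem KernelConclusionOfWitnessSmearedFrequently : open Literature.MathematicalPhysics.QuantumLattice Literature.MathematicalPhysics.AQFT Literature.MathematicalPhysics.QuantumFieldTheory in ∀ (G : Type) [Group G] [TopologicalSpace G] [IsTopologicalGroup G] [CompactSpace G] [MeasurableSpace G] [BorelSpace G], IsCompactSimpleLieGroup G → ∀ (r : LatticeRep G) (sch : SpeciesScheme (YMSpecies G)) (S₁ : SchwingerFamily (EuclideanSpace ℝ (Fin 4))), ((∀ (n : ℕ), n ≠ 0 → ∀ (f : Fin n → SchwartzMap (EuclideanSpace ℝ (Fin 4)) ℝ) (F : SchwartzMap (Fin n → (EuclideanSpace ℝ (Fin 4))) ℂ), IsTensorOf F (fun i => ofRealTest (f i)) → IsOffDiagonal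 F → Filter.Tendsto (fun k : ℕ => ((latticeSchwinger r.ρ sch (fun s => s.F) k n (fun _ => r.curvature) f : ℝ) : ℂ)) Filter.atTop (nhds (S₁ n F))) ∧ (S₁.toLabelled.IsNormalized ∧ S₁.toLabelled.IsHermitian ∧ S₁.toLabelled.HasLinearGrowth ∧ S₁.toLabelled.IsReflectionPositive ∧ S₁.toLabelled.IsSymmetric ∧ S₁.toLabelled.HasClusterProperty) ∧ (∀ (n : ℕ) (a : (EuclideanSpace ℝ (Fin 4))) (F : SchwartzMap (Fin n → (EuclideanSpace ℝ (Fin 4))) ℂ), IsOffDiagonal F → S₁ n (translateMulti a F) = S₁ n F) ∧ (∀ (R : (EuclideanSpace ℝ (Fin 4)) ≃ₗᵢ[ℝ] (EuclideanSpace ℝ (Fin 4))), LinearMap.det (R.toLinearEquiv : (EuclideanSpace ℝ (Fin 4)) →ₗ[ℝ] (EuclideanSpace ℝ (Fin 4))) = 1 → (∀ i : Fin 4, ∃ j : Fin 4, R (EuclideanSpace.single i 1) = EuclideanSpace.single j 1 ∨ R (EuclideanSpace.single i 1) = -EuclideanSpace.single j 1) → ∀ (n : ℕ) (F : SchwartzMap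 (Fin n → (EuclideanSpace ℝ (Fin 4))) ℂ), IsOffDiagonal F → S₁ n (linActMulti R F) = S₁ n F) ∧ (∃ Δ : ℝ, 0 < Δ ∧ S₁.toLabelled.HasMassGap Δ ∧ HasLatticeMassGap r sch Δ)) → (∃ (C η s₁ : ℝ), 0 < η ∧ 0 < s₁ ∧ ∀ (s : ℝ), 0 < s → s < s₁ → ∀ (ρ : ℝ), 0 < ρ → ρ ≤ s / 2 → ∀ (f : Fin 2 → SchwartzMap (EuclideanSpace ℝ (Fin 4)) ℝ) (M₀ M₁ : ℝ), tsupport ((f 0 : SchwartzMap (EuclideanSpace ℝ (Fin 4)) ℝ) : (EuclideanSpace ℝ (Fin 4)) → ℝ) ⊆ Metric.closedBall (EuclideanSpace.single (0 : Fin 4) (-s)) ρ → tsupport ((f 1 : SchwartzMap (EuclideanSpace ℝ (Fin 4)) ℝ) : (EuclideanSpace ℝ (Fin 4)) → ℝ) ⊆ Metric.closedBall (EuclideanSpace.single (0 : Fin 4) s) ρ → (∀ x, |f 0 x| ≤ M₀) → (∀ x, |f 1 x| ≤ M₁) → ∀ (δ : ℝ), 0 < δ → ∃ᶠ k in Filter.atTop,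 |latticeSchwinger r.ρ sch (fun s => s.F) k 2 (fun _ => r.curvature) f - latticeSchwinger r.ρ sch (fun s => s.F) k 1 (fun _ => r.curvature) (fun _ => f 0) * latticeSchwinger r.ρ sch (fun s => s.F) k 1 (fun _ => r.curvature) (fun _ => f 1)| ≤ C * s ^ (η - 10) * (ρ ^ 8 * M₀ * M₁) + δ) → ∃ (K : (EuclideanSpace ℝ (Fin 4)) → ℝ) (C η : ℝ), 0 < η ∧ ContinuousOn K {x : (EuclideanSpace ℝ (Fin 4)) | x ≠ 0} ∧ (∀ x : (EuclideanSpace ℝ (Fin 4)), x ≠ 0 → |K x| ≤ C * (1 + ‖x‖ ^ (η - 10))) ∧ ∀ F : SchwartzMap (Fin 2 → (EuclideanSpace ℝ (Fin 4))) ℂ, IsOffDiagonal F → MeasureTheory.Integrable (fun x : Fin 2 → (EuclideanSpace ℝ (Fin 4)) => (K (x 0 - x 1) : ℂ) * F x) ∧ S₁ 2 F = ∫ x : Fin 2 → (EuclideanSpace ℝ (Fin 4)), (K (x 0 - x 1) : ℂ) * F x :=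
  fun G _ _ _ _ _ _ hG r sch S₁ hW₁ hFr =>
    KernelConclusionOfWitnessLocalDecay G hG r sch S₁ hW₁ (LocalDecayOfSmearedFrequently G hG r sch S₁ hW₁ hFr)

/-! ## Per witness: the kernel conclusion of ONE datum ↔ its local decay T ↔ its frequent smeared bound (lead c6, appended) -/

open CruxToLocalDecayAux SemiDegenerate BoundedRenormalisation SmearedBoundEventuallyAux in
/-- **`SmearedEventuallyOfKernelConclusion`** (per datum; support for stmt-QuantumFields-11687): ONE `W₁`-datum whose two-point function
HAS the kernel conclusion of the crux satisfies the testwise eventual smeared bound (mixed `L¹`/`L∞` form), with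
`C_T = max C 0 · (2 + 3^(η−10)) + ‖κ‖²`, `η_T = min η 10`, `s₁ = 1` — the per-datum content of `SmearedBoundEventuallyOfCrux`. [folklore] -/
theorem SmearedEventuallyOfKernelConclusion : open Literature.MathematicalPhysics.QuantumLattice Literature.MathematicalPhysics.AQFT Literature.MathematicalPhysics.QuantumFieldTheory in ∀ (G : Type) [Group G] [TopologicalSpace G] [IsTopologicalGroup G] [CompactSpace G] [MeasurableSpace G] [BorelSpace G], IsCompactSimpleLieGroup G → ∀ (r : LatticeRep G) (sch : SpeciesScheme (YMSpecies G)) (S₁ : SchwingerFamily (EuclideanSpace ℝ (Fin 4))), ((∀ (n : ℕ), n ≠ 0 → ∀ (f : Fin n → SchwartzMap (EuclideanSpace ℝ (Fin 4)) ℝ) (F : SchwartzMap (Fin n → (EuclideanSpace ℝ (Fin 4))) ℂ), IsTensorOf F (fun i => ofRealTest (f i)) → IsOffDiagonal F → Filter.Tendsto (fun k : ℕ => ((latticeSchwinger r.ρ sch (fun s => s.F) k n (fun _ => r.curvature) f : ℝ) : ℂ)) Filter.atTop (nhds (S₁ n F))) ∧ (S₁.toLabelled.IsNormalized ∧ S₁.toLabelled.IsHermitian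 ∧ S₁.toLabelled.HasLinearGrowth ∧ S₁.toLabelled.IsReflectionPositive ∧ S₁.toLabelled.IsSymmetric ∧ S₁.toLabelled.HasClusterProperty) ∧ (∀ (n : ℕ) (a : (EuclideanSpace ℝ (Fin 4))) (F : SchwartzMap (Fin n → (EuclideanSpace ℝ (Fin 4))) ℂ), IsOffDiagonal F → S₁ n (translateMulti a F) = S₁ n F) ∧ (∀ (R : (EuclideanSpace ℝ (Fin 4)) ≃ₗᵢ[ℝ] (EuclideanSpace ℝ (Fin 4))), LinearMap.det (R.toLinearEquiv : (EuclideanSpace ℝ (Fin 4)) →ₗ[ℝ] (EuclideanSpace ℝ (Fin 4))) = 1 → (∀ i : Fin 4, ∃ j : Fin 4, R (EuclideanSpace.single i 1) = EuclideanSpace.single j 1 ∨ R (EuclideanSpace.single i 1) = -EuclideanSpace.single j 1) → ∀ (n : ℕ) (F : SchwartzMap (Fin n → (EuclideanSpace ℝ (Fin 4))) ℂ), IsOffDiagonal F → S₁ n (linActMulti R F) = S₁ n F) ∧ (∃ Δ : ℝ, 0 < Δ ∧ S₁.toLabelled.HasMassGap Δ ∧ HasLatticeMassGap r sch Δ)) →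 (∃ (K : (EuclideanSpace ℝ (Fin 4)) → ℝ) (C η : ℝ), 0 < η ∧ ContinuousOn K {x : (EuclideanSpace ℝ (Fin 4)) | x ≠ 0} ∧ (∀ x : (EuclideanSpace ℝ (Fin 4)), x ≠ 0 → |K x| ≤ C * (1 + ‖x‖ ^ (η - 10))) ∧ ∀ F : SchwartzMap (Fin 2 → (EuclideanSpace ℝ (Fin 4))) ℂ, IsOffDiagonal F → MeasureTheory.Integrable (fun x : Fin 2 → (EuclideanSpace ℝ (Fin 4)) => (K (x 0 - x 1) : ℂ) * F x) ∧ S₁ 2 F = ∫ x : Fin 2 → (EuclideanSpace ℝ (Fin 4)), (K (x 0 - x 1) : ℂ) * F x) → ∃ (C η s₁ : ℝ), 0 < η ∧ 0 < s₁ ∧ ∀ (s : ℝ), 0 < s → s < s₁ → ∀ (ρ : ℝ), 0 < ρ → ρ ≤ s / 2 → ∀ (f : Fin 2 → SchwartzMap (EuclideanSpace ℝ (Fin 4)) ℝ) (M₀ M₁ : ℝ), tsupport ((f 0 : SchwartzMap (EuclideanSpace ℝ (Fin 4)) ℝ) : (EuclideanSpace ℝ (Fin 4)) → ℝ) ⊆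 Metric.closedBall (EuclideanSpace.single (0 : Fin 4) (-s)) ρ → tsupport ((f 1 : SchwartzMap (EuclideanSpace ℝ (Fin 4)) ℝ) : (EuclideanSpace ℝ (Fin 4)) → ℝ) ⊆ Metric.closedBall (EuclideanSpace.single (0 : Fin 4) s) ρ → (∀ x, |f 0 x| ≤ M₀) → (∀ x, |f 1 x| ≤ M₁) → ∀ (δ : ℝ), 0 < δ → ∀ᶠ k in Filter.atTop, |latticeSchwinger r.ρ sch (fun s => s.F) k 2 (fun _ => r.curvature) f - latticeSchwinger r.ρ sch (fun s => s.F) k 1 (fun _ => r.curvature) (fun _ => f 0) * latticeSchwinger r.ρ sch (fun s => s.F) k 1 (fun _ => r.curvature) (fun _ => f 1)| ≤ C * s ^ (η - 10) * ((∫ x : (EuclideanSpace ℝ (Fin 4)), |f 0 x|) * (∫ x : (EuclideanSpace ℝ (Fin 4)), |f 1 x|) + ρ ^ 8 * M₀ * M₁) + δ := by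
  intro G i1 i2 i3 i4 i5 i6 _ r sch S₁ hW₁ hKC
  obtain ⟨K, C, η, hη, -, hbd, hrep⟩ := hKC
  have htie := hW₁.1
  have htr := hW₁.2.2.1
  -- `S₁ 1 = κ∫` on real one-point tensors
  obtain ⟨κ, hκ⟩ := exists_degreeOne_eq_const_mul_realIntegral S₁ htr
  have hC : C ≤ max C 0 := le_max_left _ _
  have hC0 : 0 ≤ max C 0 := le_max_right _ _
  refine ⟨max C 0 * (2 + (3 : ℝ) ^ (η - 10)) + ‖κ‖ ^ 2, min η 10, 1, lt_min hη (by norm_num), one_pos,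
    ?_⟩
  intro s hs hs1 ρ hρ hρs f M₀ M₁ hsupp₀ hsupp₁ hM₀ hM₁ δ hδ
  have hM₀nn : 0 ≤ M₀ := (abs_nonneg _).trans (hM₀ 0)
  have hM₁nn : 0 ≤ M₁ := (abs_nonneg _).trans (hM₁ 0)
  have hI₀ : 0 ≤ ∫ x : EuclideanSpace ℝ (Fin 4), |f 0 x| := integral_nonneg fun _ => abs_nonneg _
  have hI₁ : 0 ≤ ∫ x : EuclideanSpace ℝ (Fin 4), |f 1 x| := integral_nonneg fun _ => abs_nonneg _
  have hPnn : 0 ≤ (∫ x : EuclideanSpace ℝ (Fin 4), |f 0 x|) * (∫ x : EuclideanSpace ℝ (Fin 4), |f 1 x|) :=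
    mul_nonneg hI₀ hI₁
  have hWnn : 0 ≤ ρ ^ 8 * M₀ * M₁ := by positivity
  -- the real tensors `F = f 0 ⊗ f 1`, `F₀ = f 0`, `F₁ = f 1`
  obtain ⟨F, hFt⟩ := exists_isTensorOf (n := 2) (fun i => ofRealTest (f i))
  obtain ⟨F₀, hF₀⟩ := exists_isTensorOf (n := 1) (fun _ : Fin 1 => ofRealTest (f 0))
  obtain ⟨F₁, hF₁⟩ := exists_isTensorOf (n := 1) (fun _ : Fin 1 => ofRealTest (f 1))
  -- the two closed balls are disjoint, so `F` is off-diagonal and the kernel represents `S₁ 2 F`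
  have hdisj : Disjoint (tsupport ((f 0 : 𝓢(EuclideanSpace ℝ (Fin 4), ℝ)) : EuclideanSpace ℝ (Fin 4) → ℝ))
      (tsupport ((f 1 : 𝓢(EuclideanSpace ℝ (Fin 4), ℝ)) : EuclideanSpace ℝ (Fin 4) → ℝ)) :=
    Disjoint.mono hsupp₀ hsupp₁ (disjoint_closedBall_single hs hρs)
  have hFoff : IsOffDiagonal F := isOffDiagonal_of_isTensorOf_of_disjoint hFt hdisj
  obtain ⟨-, hSF⟩ := hrep F hFoff
  -- (1) `|K| ≤ A` on the shell `s ≤ ‖ξ‖ ≤ 3s`, hence `‖S₁ 2 F‖ ≤ A (∫|f 0|)(∫|f 1|)`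
  have hK : ∀ ξ : EuclideanSpace ℝ (Fin 4), s ≤ ‖ξ‖ → ‖ξ‖ ≤ 3 * s →
      |K ξ| ≤ max C 0 * (1 + s ^ (η - 10) + (3 * s) ^ (η - 10)) := by
    intro ξ h1 h2
    have hξ : ξ ≠ 0 := by
      intro h0
      rw [h0, norm_zero] at h1
      linarith
    have hpos : 0 ≤ 1 + ‖ξ‖ ^ (η - 10) := by positivity
    calc |K ξ| ≤ C * (1 + ‖ξ‖ ^ (η - 10)) := hbd ξ hξ
      _ ≤ max C 0 * (1 + ‖ξ‖ ^ (η - 10)) := mul_le_mul_of_nonneg_right hC hpos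
      _ ≤ max C 0 * (1 + s ^ (η - 10) + (3 * s) ^ (η - 10)) := by
          refine mul_le_mul_of_nonneg_left ?_ hC0
          linarith [rpow_shell_le (η := η) hs h1 h2]
  have h2F : ‖S₁ 2 F‖ ≤ max C 0 * (1 + s ^ (η - 10) + (3 * s) ^ (η - 10)) *
      ((∫ x : EuclideanSpace ℝ (Fin 4), |f 0 x|) * (∫ x : EuclideanSpace ℝ (Fin 4), |f 1 x|)) := by
    rw [hSF, ← mul_assoc]
    exact norm_integral_kernel_tensor_le hs hρs hK f hFt hsupp₀ hsupp₁
  -- (2) the disconnected part `S₁ 1 F₀ · S₁ 1 F₁ = κ² (∫ f 0)(∫ f 1)`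
  have hdisc : ‖S₁ 1 F₀ * S₁ 1 F₁‖ ≤
      ‖κ‖ ^ 2 * ((∫ x : EuclideanSpace ℝ (Fin 4), |f 0 x|) * (∫ x : EuclideanSpace ℝ (Fin 4), |f 1 x|)) := by
    rw [hκ (f 0) F₀ hF₀, hκ (f 1) F₁ hF₁]
    exact (norm_disconnected_le κ f).trans_eq (mul_assoc _ _ _)
  -- (3) constants
  have hA : max C 0 * (1 + s ^ (η - 10) + (3 * s) ^ (η - 10)) ≤
      max C 0 * (2 + (3 : ℝ) ^ (η - 10)) * s ^ (min η 10 - 10) := by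
    rw [mul_assoc]
    exact mul_le_mul_of_nonneg_left (shell_const_le hs hs1.le) hC0
  have ht1 : (1 : ℝ) ≤ s ^ (min η 10 - 10) :=
    Real.one_le_rpow_of_pos_of_le_one_of_nonpos hs hs1.le (by linarith [min_le_right η 10])
  have hκt : ‖κ‖ ^ 2 ≤ ‖κ‖ ^ 2 * s ^ (min η 10 - 10) := le_mul_of_one_le_right (sq_nonneg _) ht1
  have hCT : 0 ≤ (max C 0 * (2 + (3 : ℝ) ^ (η - 10)) + ‖κ‖ ^ 2) * s ^ (min η 10 - 10) :=
    mul_nonneg (add_nonneg (mul_nonneg hC0 (by positivity)) (sq_nonneg _)) (Real.rpow_nonneg hs.le _)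
  have hlim : ‖S₁ 2 F - S₁ 1 F₀ * S₁ 1 F₁‖ ≤
      (max C 0 * (2 + (3 : ℝ) ^ (η - 10)) + ‖κ‖ ^ 2) * s ^ (min η 10 - 10) *
        ((∫ x : EuclideanSpace ℝ (Fin 4), |f 0 x|) * (∫ x : EuclideanSpace ℝ (Fin 4), |f 1 x|) +
          ρ ^ 8 * M₀ * M₁) :=
    le_const_mul_of_parts (norm_sub_le _ _) h2F hdisc hA hκt hPnn hWnn hCT
  -- (4) the lattice tie at `n = 2, 1`
  have hu := htie 2 two_ne_zero f F hFt hFoff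
  have hv := htie 1 one_ne_zero (fun _ => f 0) F₀ hF₀ (HypercubicLimit.Negative.isOffDiagonal_fin_one F₀)
  have hw := htie 1 one_ne_zero (fun _ => f 1) F₁ hF₁ (HypercubicLimit.Negative.isOffDiagonal_fin_one F₁)
  filter_upwards [eventually_norm_le_add_of_tendsto (hu.sub (hv.mul hw)) hlim hδ] with k hk
  rwa [norm_ofReal_sub_mul] at hk

open SmearedFrequentlyAux in
/-- **`SmearedFrequentlyOfKernelConclusion`** (per datum; support for stmt-QuantumFields-11687): the same datum satisfies the testwise
FREQUENT pure-`L∞` smeared bound (constant `C_T⁺ (V² + 1)`, `V = vol B̄(0,1)`). [folklore] -/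
theorem SmearedFrequentlyOfKernelConclusion : open Literature.MathematicalPhysics.QuantumLattice Literature.MathematicalPhysics.AQFT Literature.MathematicalPhysics.QuantumFieldTheory in ∀ (G : Type) [Group G] [TopologicalSpace G] [IsTopologicalGroup G] [CompactSpace G] [MeasurableSpace G] [BorelSpace G], IsCompactSimpleLieGroup G → ∀ (r : LatticeRep G) (sch : SpeciesScheme (YMSpecies G)) (S₁ : SchwingerFamily (EuclideanSpace ℝ (Fin 4))), ((∀ (n : ℕ), n ≠ 0 → ∀ (f : Fin n → SchwartzMap (EuclideanSpace ℝ (Fin 4)) ℝ) (F : SchwartzMap (Fin n → (EuclideanSpace ℝ (Fin 4))) ℂ), IsTensorOf F (fun i => ofRealTest (f i)) → IsOffDiagonal F → Filter.Tendsto (fun k : ℕ => ((latticeSchwinger r.ρ sch (fun s => s.F) k n (fun _ => r.curvature) f : ℝ) : ℂ)) Filter.atTop (nhds (S₁ n F))) ∧ (S₁.toLabelled.IsNormalized ∧ S₁.toLabelled.IsHermitian ∧ S₁.toLabelled.HasLinearGrowth ∧ S₁.toLabelled.IsReflectionPositive ∧ S₁.toLabelled.IsSymmetric ∧ S₁.toLabelled.HasClusterProperty)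 ∧ (∀ (n : ℕ) (a : (EuclideanSpace ℝ (Fin 4))) (F : SchwartzMap (Fin n → (EuclideanSpace ℝ (Fin 4))) ℂ), IsOffDiagonal F → S₁ n (translateMulti a F) = S₁ n F) ∧ (∀ (R : (EuclideanSpace ℝ (Fin 4)) ≃ₗᵢ[ℝ] (EuclideanSpace ℝ (Fin 4))), LinearMap.det (R.toLinearEquiv : (EuclideanSpace ℝ (Fin 4)) →ₗ[ℝ] (EuclideanSpace ℝ (Fin 4))) = 1 → (∀ i : Fin 4, ∃ j : Fin 4, R (EuclideanSpace.single i 1) = EuclideanSpace.single j 1 ∨ R (EuclideanSpace.single i 1) = -EuclideanSpace.single j 1) → ∀ (n : ℕ) (F : SchwartzMap (Fin n → (EuclideanSpace ℝ (Fin 4))) ℂ), IsOffDiagonal F → S₁ n (linActMulti R F) = S₁ n F) ∧ (∃ Δ : ℝ, 0 < Δ ∧ S₁.toLabelled.HasMassGap Δ ∧ HasLatticeMassGap r sch Δ)) → (∃ (K : (EuclideanSpace ℝ (Fin 4)) → ℝ) (C η : ℝ), 0 < η ∧ ContinuousOn K {x : (EuclideanSpace ℝ (Fin 4)) | x ≠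 0} ∧ (∀ x : (EuclideanSpace ℝ (Fin 4)), x ≠ 0 → |K x| ≤ C * (1 + ‖x‖ ^ (η - 10))) ∧ ∀ F : SchwartzMap (Fin 2 → (EuclideanSpace ℝ (Fin 4))) ℂ, IsOffDiagonal F → MeasureTheory.Integrable (fun x : Fin 2 → (EuclideanSpace ℝ (Fin 4)) => (K (x 0 - x 1) : ℂ) * F x) ∧ S₁ 2 F = ∫ x : Fin 2 → (EuclideanSpace ℝ (Fin 4)), (K (x 0 - x 1) : ℂ) * F x) → ∃ (C η s₁ : ℝ), 0 < η ∧ 0 < s₁ ∧ ∀ (s : ℝ), 0 < s → s < s₁ → ∀ (ρ : ℝ), 0 < ρ → ρ ≤ s / 2 → ∀ (f : Fin 2 → SchwartzMap (EuclideanSpace ℝ (Fin 4)) ℝ) (M₀ M₁ : ℝ), tsupport ((f 0 : SchwartzMap (EuclideanSpace ℝ (Fin 4)) ℝ) : (EuclideanSpace ℝ (Fin 4)) → ℝ) ⊆ Metric.closedBall (EuclideanSpace.single (0 : Fin 4) (-s)) ρ → tsupport ((f 1 : SchwartzMap (EuclideanSpace ℝ (Fin 4)) ℝ) : (EuclideanSpace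 ℝ (Fin 4)) → ℝ) ⊆ Metric.closedBall (EuclideanSpace.single (0 : Fin 4) s) ρ → (∀ x, |f 0 x| ≤ M₀) → (∀ x, |f 1 x| ≤ M₁) → ∀ (δ : ℝ), 0 < δ → ∃ᶠ k in Filter.atTop, |latticeSchwinger r.ρ sch (fun s => s.F) k 2 (fun _ => r.curvature) f - latticeSchwinger r.ρ sch (fun s => s.F) k 1 (fun _ => r.curvature) (fun _ => f 0) * latticeSchwinger r.ρ sch (fun s => s.F) k 1 (fun _ => r.curvature) (fun _ => f 1)| ≤ C * s ^ (η - 10) * (ρ ^ 8 * M₀ * M₁) + δ := by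
  intro G _ _ _ _ _ _ hG r sch S₁ hW₁ hKC
  obtain ⟨C, η, s₁, hη, hs₁, hev⟩ := SmearedEventuallyOfKernelConclusion G hG r sch S₁ hW₁ hKC
  set V : ℝ := (volume (closedBall (0 : EuclideanSpace ℝ (Fin 4)) 1)).toReal with hV
  refine ⟨max C 0 * (V ^ 2 + 1), η, s₁, hη, hs₁, ?_⟩
  intro s hs hss₁ ρ hρ hρs f M₀ M₁ hsupp₀ hsupp₁ hM₀ hM₁ δ hδ
  have hM₀nn : 0 ≤ M₀ := (abs_nonneg _).trans (hM₀ 0)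
  have hM₁nn : 0 ≤ M₁ := (abs_nonneg _).trans (hM₁ 0)
  have hI₀ := integral_abs_le_pow_four (f 0) _ hρ.le hsupp₀ hM₀
  have hI₁ := integral_abs_le_pow_four (f 1) _ hρ.le hsupp₁ hM₁
  refine ((hev s hs hss₁ ρ hρ hρs f M₀ M₁ hsupp₀ hsupp₁ hM₀ hM₁ δ hδ).mono fun k hk => hk.trans ?_).frequently
  have key := mixed_le_pure (t := s ^ (η - 10)) (le_max_left C 0) (le_max_right C 0) (Real.rpow_nonneg hs.le _)
    hI₀ hI₁ (integral_nonneg fun x => abs_nonneg _) (integral_nonneg fun x => abs_nonneg _) hM₀nn hM₁nn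
    ENNReal.toReal_nonneg
  linarith

/-- **`KernelConclusionIffSmearedFrequentlyDatum`** (per datum; support for stmt-QuantumFields-11687, skeleton v18 of line
`sixteen-charts-analytic-kernel`): for ONE `W₁`-datum, the kernel conclusion of `CurvatureKernelBound` for its two-point function is
EQUIVALENT to the testwise frequent pure-`L∞` smeared bound on the renormalised truncated lattice two-point function of its scheme.
Folding the latter (or T) of the witness into the existence leg is therefore lossless per witness. [folklore] -/
theorem KernelConclusionIffSmearedFrequentlyDatum : open Literature.MathematicalPhysics.QuantumLattice Literature.MathematicalPhysics.AQFT Literature.MathematicalPhysics.QuantumFieldTheory in ∀ (G : Type) [Group G] [TopologicalSpace G] [IsTopologicalGroup G] [CompactSpace G] [MeasurableSpace G] [BorelSpace G], IsCompactSimpleLieGroup G → ∀ (r : LatticeRep G) (sch : SpeciesScheme (YMSpecies G)) (S₁ : SchwingerFamily (EuclideanSpace ℝ (Fin 4))), ((∀ (n : ℕ), n ≠ 0 → ∀ (f : Fin n → SchwartzMap (EuclideanSpace ℝ (Fin 4)) ℝ) (F : SchwartzMap (Fin n → (EuclideanSpace ℝ (Fin 4))) ℂ), IsTensorOf F (fun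 i => ofRealTest (f i)) → IsOffDiagonal F → Filter.Tendsto (fun k : ℕ => ((latticeSchwinger r.ρ sch (fun s => s.F) k n (fun _ => r.curvature) f : ℝ) : ℂ)) Filter.atTop (nhds (S₁ n F))) ∧ (S₁.toLabelled.IsNormalized ∧ S₁.toLabelled.IsHermitian ∧ S₁.toLabelled.HasLinearGrowth ∧ S₁.toLabelled.IsReflectionPositive ∧ S₁.toLabelled.IsSymmetric ∧ S₁.toLabelled.HasClusterProperty) ∧ (∀ (n : ℕ) (a : (EuclideanSpace ℝ (Fin 4))) (F : SchwartzMap (Fin n → (EuclideanSpace ℝ (Fin 4))) ℂ), IsOffDiagonal F → S₁ n (translateMulti a F) = S₁ n F) ∧ (∀ (R : (EuclideanSpace ℝ (Fin 4)) ≃ₗᵢ[ℝ] (EuclideanSpace ℝ (Fin 4))), LinearMap.det (R.toLinearEquiv : (EuclideanSpace ℝ (Fin 4)) →ₗ[ℝ] (EuclideanSpace ℝ (Fin 4))) = 1 → (∀ i : Fin 4, ∃ j : Fin 4, R (EuclideanSpace.single i 1) = EuclideanSpace.single j 1 ∨ R (EuclideanSpace.single i 1) = -EuclideanSpace.single j 1)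 → ∀ (n : ℕ) (F : SchwartzMap (Fin n → (EuclideanSpace ℝ (Fin 4))) ℂ), IsOffDiagonal F → S₁ n (linActMulti R F) = S₁ n F) ∧ (∃ Δ : ℝ, 0 < Δ ∧ S₁.toLabelled.HasMassGap Δ ∧ HasLatticeMassGap r sch Δ)) → ((∃ (K : (EuclideanSpace ℝ (Fin 4)) → ℝ) (C η : ℝ), 0 < η ∧ ContinuousOn K {x : (EuclideanSpace ℝ (Fin 4)) | x ≠ 0} ∧ (∀ x : (EuclideanSpace ℝ (Fin 4)), x ≠ 0 → |K x| ≤ C * (1 + ‖x‖ ^ (η - 10))) ∧ ∀ F : SchwartzMap (Fin 2 → (EuclideanSpace ℝ (Fin 4))) ℂ, IsOffDiagonal F → MeasureTheory.Integrable (fun x : Fin 2 → (EuclideanSpace ℝ (Fin 4)) => (K (x 0 - x 1) : ℂ) * F x) ∧ S₁ 2 F = ∫ x : Fin 2 → (EuclideanSpace ℝ (Fin 4)), (K (x 0 - x 1) : ℂ) * F x) ↔ (∃ (C η s₁ : ℝ), 0 < η ∧ 0 < s₁ ∧ ∀ (s : ℝ), 0 < s → s < s₁ → ∀ (ρ : ℝ),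 0 < ρ → ρ ≤ s / 2 → ∀ (f : Fin 2 → SchwartzMap (EuclideanSpace ℝ (Fin 4)) ℝ) (M₀ M₁ : ℝ), tsupport ((f 0 : SchwartzMap (EuclideanSpace ℝ (Fin 4)) ℝ) : (EuclideanSpace ℝ (Fin 4)) → ℝ) ⊆ Metric.closedBall (EuclideanSpace.single (0 : Fin 4) (-s)) ρ → tsupport ((f 1 : SchwartzMap (EuclideanSpace ℝ (Fin 4)) ℝ) : (EuclideanSpace ℝ (Fin 4)) → ℝ) ⊆ Metric.closedBall (EuclideanSpace.single (0 : Fin 4) s) ρ → (∀ x, |f 0 x| ≤ M₀) → (∀ x, |f 1 x| ≤ M₁) → ∀ (δ : ℝ), 0 < δ → ∃ᶠ k in Filter.atTop, |latticeSchwinger r.ρ sch (fun s => s.F) k 2 (fun _ => r.curvature) f - latticeSchwinger r.ρ sch (fun s => s.F) k 1 (fun _ => r.curvature) (fun _ => f 0) * latticeSchwinger r.ρ sch (fun s => s.F) k 1 (fun _ => r.curvature) (fun _ => f 1)| ≤ C * s ^ (η - 10) * (ρ ^ 8 * M₀ * M₁) + δ)) :=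
  fun G _ _ _ _ _ _ hG r sch S₁ hW₁ =>
    ⟨SmearedFrequentlyOfKernelConclusion G hG r sch S₁ hW₁, KernelConclusionOfWitnessSmearedFrequently G hG r sch S₁ hW₁⟩

open CruxToLocalDecayAux SemiDegenerate in
/-- **`LocalDecayOfKernelConclusion`** (per datum; support for stmt-QuantumFields-11687): a datum whose two-point function HAS the kernel
conclusion of the crux satisfies the two-point local decay T (`A = max C 0 · (1 + s^(η−10) + (3s)^(η−10))`, `B = 0`, `η_T = min η 10`,
`C_T = max C 0 · (2 + 3^(η−10))`, `s₁ = 1`, `r₀ = s/2`) — the per-datum content of `CruxToLocalDecay`; `W₁` is not used. [folklore] -/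
theorem LocalDecayOfKernelConclusion : open Literature.MathematicalPhysics.QuantumLattice Literature.MathematicalPhysics.AQFT Literature.MathematicalPhysics.QuantumFieldTheory in ∀ (G : Type) [Group G] [TopologicalSpace G] [IsTopologicalGroup G] [CompactSpace G] [MeasurableSpace G] [BorelSpace G], IsCompactSimpleLieGroup G → ∀ (r : LatticeRep G) (sch : SpeciesScheme (YMSpecies G)) (S₁ : SchwingerFamily (EuclideanSpace ℝ (Fin 4))), ((∀ (n : ℕ), n ≠ 0 → ∀ (f : Fin n → SchwartzMap (EuclideanSpace ℝ (Fin 4)) ℝ) (F : SchwartzMap (Fin n → (EuclideanSpace ℝ (Fin 4))) ℂ), IsTensorOf F (fun i => ofRealTest (f i)) → IsOffDiagonal F → Filter.Tendsto (fun k : ℕ => ((latticeSchwinger r.ρ sch (fun s => s.F) k n (fun _ => r.curvature) f : ℝ) : ℂ)) Filter.atTop (nhds (S₁ n F))) ∧ (S₁.toLabelled.IsNormalized ∧ S₁.toLabelled.IsHermitian ∧ S₁.toLabelled.HasLinearGrowth ∧ S₁.toLabelled.IsReflectionPositive ∧ S₁.toLabelled.IsSymmetric ∧ S₁.toLabelled.HasClusterProperty)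 ∧ (∀ (n : ℕ) (a : (EuclideanSpace ℝ (Fin 4))) (F : SchwartzMap (Fin n → (EuclideanSpace ℝ (Fin 4))) ℂ), IsOffDiagonal F → S₁ n (translateMulti a F) = S₁ n F) ∧ (∀ (R : (EuclideanSpace ℝ (Fin 4)) ≃ₗᵢ[ℝ] (EuclideanSpace ℝ (Fin 4))), LinearMap.det (R.toLinearEquiv : (EuclideanSpace ℝ (Fin 4)) →ₗ[ℝ] (EuclideanSpace ℝ (Fin 4))) = 1 → (∀ i : Fin 4, ∃ j : Fin 4, R (EuclideanSpace.single i 1) = EuclideanSpace.single j 1 ∨ R (EuclideanSpace.single i 1) = -EuclideanSpace.single j 1) → ∀ (n : ℕ) (F : SchwartzMap (Fin n → (EuclideanSpace ℝ (Fin 4))) ℂ), IsOffDiagonal F → S₁ n (linActMulti R F) = S₁ n F) ∧ (∃ Δ : ℝ, 0 < Δ ∧ S₁.toLabelled.HasMassGap Δ ∧ HasLatticeMassGap r sch Δ)) → (∃ (K : (EuclideanSpace ℝ (Fin 4)) → ℝ) (C η : ℝ), 0 < η ∧ ContinuousOn K {x : (EuclideanSpace ℝ (Fin 4)) | x ≠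 0} ∧ (∀ x : (EuclideanSpace ℝ (Fin 4)), x ≠ 0 → |K x| ≤ C * (1 + ‖x‖ ^ (η - 10))) ∧ ∀ F : SchwartzMap (Fin 2 → (EuclideanSpace ℝ (Fin 4))) ℂ, IsOffDiagonal F → MeasureTheory.Integrable (fun x : Fin 2 → (EuclideanSpace ℝ (Fin 4)) => (K (x 0 - x 1) : ℂ) * F x) ∧ S₁ 2 F = ∫ x : Fin 2 → (EuclideanSpace ℝ (Fin 4)), (K (x 0 - x 1) : ℂ) * F x) → ∃ (C η s₁ : ℝ), 0 < η ∧ 0 < s₁ ∧ (∀ (s : ℝ), 0 < s → s < s₁ → ∃ (r₀ A B : ℝ), 0 < r₀ ∧ 0 ≤ A ∧ 0 ≤ B ∧ A + B ≤ C * s ^ (η - 10) ∧ (∀ (r : ℝ), 0 < r → r ≤ r₀ → ∀ (f : Fin 2 → SchwartzMap (EuclideanSpace ℝ (Fin 4)) ℝ) (F : SchwartzMap (Fin 2 → (EuclideanSpace ℝ (Fin 4))) ℂ) (M₀ M₁ : ℝ), IsTensorOf F (fun i => ofRealTest (f i)) → tsupport ((f 0 : SchwartzMap (EuclideanSpace ℝ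 (Fin 4)) ℝ) : (EuclideanSpace ℝ (Fin 4)) → ℝ) ⊆ Metric.closedBall (EuclideanSpace.single (0 : Fin 4) (-s)) r → tsupport ((f 1 : SchwartzMap (EuclideanSpace ℝ (Fin 4)) ℝ) : (EuclideanSpace ℝ (Fin 4)) → ℝ) ⊆ Metric.closedBall (EuclideanSpace.single (0 : Fin 4) s) r → (∀ x, |f 0 x| ≤ M₀) → (∀ x, |f 1 x| ≤ M₁) → ‖S₁ 2 F‖ ≤ A * (∫ x : (EuclideanSpace ℝ (Fin 4)), |f 0 x|) * (∫ x : (EuclideanSpace ℝ (Fin 4)), |f 1 x|) + B * r ^ 8 * M₀ * M₁)) := by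
  intro G i1 i2 i3 i4 i5 i6 _ r sch S₁ _ hKC
  obtain ⟨K, C, η, hη, -, hbd, hrep⟩ := hKC
  have hC : C ≤ max C 0 := le_max_left _ _
  have hC0 : 0 ≤ max C 0 := le_max_right _ _
  refine ⟨max C 0 * (2 + (3 : ℝ) ^ (η - 10)), min η 10, 1, lt_min hη (by norm_num), one_pos,
    fun s hs hs1 => ?_⟩
  have hshell : 0 ≤ 1 + s ^ (η - 10) + (3 * s) ^ (η - 10) := by positivity
  refine ⟨s / 2, max C 0 * (1 + s ^ (η - 10) + (3 * s) ^ (η - 10)), 0, half_pos hs,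
    mul_nonneg hC0 hshell, le_rfl, ?_, ?_⟩
  · rw [add_zero, mul_assoc]
    exact mul_le_mul_of_nonneg_left (shell_const_le hs hs1.le) hC0
  · intro ρ hρ hρs f F _ _ hFt hsupp₀ hsupp₁ _ _
    have hdisj : Disjoint (tsupport ((f 0 : 𝓢(EuclideanSpace ℝ (Fin 4), ℝ)) : EuclideanSpace ℝ (Fin 4) → ℝ))
        (tsupport ((f 1 : 𝓢(EuclideanSpace ℝ (Fin 4), ℝ)) : EuclideanSpace ℝ (Fin 4) → ℝ)) :=
      Disjoint.mono hsupp₀ hsupp₁ (disjoint_closedBall_single hs hρs)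
    have hFoff : IsOffDiagonal F := isOffDiagonal_of_isTensorOf_of_disjoint hFt hdisj
    obtain ⟨-, hSF⟩ := hrep F hFoff
    have hK : ∀ ξ : EuclideanSpace ℝ (Fin 4), s ≤ ‖ξ‖ → ‖ξ‖ ≤ 3 * s →
        |K ξ| ≤ max C 0 * (1 + s ^ (η - 10) + (3 * s) ^ (η - 10)) := by
      intro ξ h1 h2
      have hξ : ξ ≠ 0 := by
        intro h0
        rw [h0, norm_zero] at h1
        linarith
      have hpos : 0 ≤ 1 + ‖ξ‖ ^ (η - 10) := by positivity
      calc |K ξ| ≤ C * (1 + ‖ξ‖ ^ (η - 10)) := hbd ξ hξ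
        _ ≤ max C 0 * (1 + ‖ξ‖ ^ (η - 10)) := mul_le_mul_of_nonneg_right hC hpos
        _ ≤ max C 0 * (1 + s ^ (η - 10) + (3 * s) ^ (η - 10)) := by
            refine mul_le_mul_of_nonneg_left ?_ hC0
            linarith [rpow_shell_le (η := η) hs h1 h2]
    rw [hSF, zero_mul, zero_mul, zero_mul, add_zero]
    exact norm_integral_kernel_tensor_le hs hρs hK f hFt hsupp₀ hsupp₁

/-- **`KernelConclusionIffLocalDecayDatum`** (per datum; support for stmt-QuantumFields-11687): for ONE `W₁`-datum, the kernel conclusion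
of `CurvatureKernelBound` for its two-point function is EQUIVALENT to its two-point local decay T — so the T conjunct of the compiled
fold proposal (`Lines/closes_fold_proposal.lean`) asks of the witness exactly what the crux would have delivered for it. [folklore] -/
theorem KernelConclusionIffLocalDecayDatum : open Literature.MathematicalPhysics.QuantumLattice Literature.MathematicalPhysics.AQFT Literature.MathematicalPhysics.QuantumFieldTheory in ∀ (G : Type) [Group G] [TopologicalSpace G] [IsTopologicalGroup G] [CompactSpace G] [MeasurableSpace G] [BorelSpace G], IsCompactSimpleLieGroup G → ∀ (r : LatticeRep G) (sch : SpeciesScheme (YMSpecies G)) (S₁ : SchwingerFamily (EuclideanSpace ℝ (Fin 4))), ((∀ (n : ℕ), n ≠ 0 → ∀ (f : Fin n → SchwartzMap (EuclideanSpace ℝ (Fin 4)) ℝ) (F : SchwartzMap (Fin n → (EuclideanSpace ℝ (Fin 4))) ℂ), IsTensorOf F (fun i => ofRealTest (f i)) → IsOffDiagonal F → Filter.Tendsto (fun k : ℕ => ((latticeSchwinger r.ρ sch (fun s => s.F) k n (fun _ => r.curvature) f : ℝ) : ℂ)) Filter.atTop (nhds (S₁ n F))) ∧ (S₁.toLabelled.IsNormalized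 ∧ S₁.toLabelled.IsHermitian ∧ S₁.toLabelled.HasLinearGrowth ∧ S₁.toLabelled.IsReflectionPositive ∧ S₁.toLabelled.IsSymmetric ∧ S₁.toLabelled.HasClusterProperty) ∧ (∀ (n : ℕ) (a : (EuclideanSpace ℝ (Fin 4))) (F : SchwartzMap (Fin n → (EuclideanSpace ℝ (Fin 4))) ℂ), IsOffDiagonal F → S₁ n (translateMulti a F) = S₁ n F) ∧ (∀ (R : (EuclideanSpace ℝ (Fin 4)) ≃ₗᵢ[ℝ] (EuclideanSpace ℝ (Fin 4))), LinearMap.det (R.toLinearEquiv : (EuclideanSpace ℝ (Fin 4)) →ₗ[ℝ] (EuclideanSpace ℝ (Fin 4))) = 1 → (∀ i : Fin 4, ∃ j : Fin 4, R (EuclideanSpace.single i 1) = EuclideanSpace.single j 1 ∨ R (EuclideanSpace.single i 1) = -EuclideanSpace.single j 1) → ∀ (n : ℕ) (F : SchwartzMap (Fin n → (EuclideanSpace ℝ (Fin 4))) ℂ), IsOffDiagonal F → S₁ n (linActMulti R F) = S₁ n F) ∧ (∃ Δ : ℝ, 0 < Δ ∧ S₁.toLabelled.HasMassGap Δ ∧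 HasLatticeMassGap r sch Δ)) → ((∃ (K : (EuclideanSpace ℝ (Fin 4)) → ℝ) (C η : ℝ), 0 < η ∧ ContinuousOn K {x : (EuclideanSpace ℝ (Fin 4)) | x ≠ 0} ∧ (∀ x : (EuclideanSpace ℝ (Fin 4)), x ≠ 0 → |K x| ≤ C * (1 + ‖x‖ ^ (η - 10))) ∧ ∀ F : SchwartzMap (Fin 2 → (EuclideanSpace ℝ (Fin 4))) ℂ, IsOffDiagonal F → MeasureTheory.Integrable (fun x : Fin 2 → (EuclideanSpace ℝ (Fin 4)) => (K (x 0 - x 1) : ℂ) * F x) ∧ S₁ 2 F = ∫ x : Fin 2 → (EuclideanSpace ℝ (Fin 4)), (K (x 0 - x 1) : ℂ) * F x) ↔ (∃ (C η s₁ : ℝ), 0 < η ∧ 0 < s₁ ∧ (∀ (s : ℝ), 0 < s → s < s₁ → ∃ (r₀ A B : ℝ), 0 < r₀ ∧ 0 ≤ A ∧ 0 ≤ B ∧ A + B ≤ C * s ^ (η - 10) ∧ (∀ (r : ℝ), 0 < r → r ≤ r₀ → ∀ (f : Fin 2 → SchwartzMap (EuclideanSpace ℝ (Fin 4)) ℝ)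 (F : SchwartzMap (Fin 2 → (EuclideanSpace ℝ (Fin 4))) ℂ) (M₀ M₁ : ℝ), IsTensorOf F (fun i => ofRealTest (f i)) → tsupport ((f 0 : SchwartzMap (EuclideanSpace ℝ (Fin 4)) ℝ) : (EuclideanSpace ℝ (Fin 4)) → ℝ) ⊆ Metric.closedBall (EuclideanSpace.single (0 : Fin 4) (-s)) r → tsupport ((f 1 : SchwartzMap (EuclideanSpace ℝ (Fin 4)) ℝ) : (EuclideanSpace ℝ (Fin 4)) → ℝ) ⊆ Metric.closedBall (EuclideanSpace.single (0 : Fin 4) s) r → (∀ x, |f 0 x| ≤ M₀) → (∀ x, |f 1 x| ≤ M₁) → ‖S₁ 2 F‖ ≤ A * (∫ x : (EuclideanSpace ℝ (Fin 4)), |f 0 x|) * (∫ x : (EuclideanSpace ℝ (Fin 4)), |f 1 x|) + B * r ^ 8 * M₀ * M₁)))) :=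
  fun G _ _ _ _ _ _ hG r sch S₁ hW₁ =>
    ⟨LocalDecayOfKernelConclusion G hG r sch S₁ hW₁, KernelConclusionOfWitnessLocalDecay G hG r sch S₁ hW₁⟩

end Summit.QuantumFields.YangMills.Theorems.CurvatureKernel

end
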